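import Summits.BirchSwinnertonDyer.BirchSwinnertonDyer.Theorems.PrintX9EvenBranchMuZero
import Summits.BirchSwinnertonDyer.BirchSwinnertonDyer.Theorems.PrintX10bAnalyticMuZeroX10bStubVasersteinAway
import Summits.BirchSwinnertonDyer.BirchSwinnertonDyer.Theorems.PrintX10bAnalyticMuZeroX10bStubTheoremBOfVasersteinAway
import Literature.NumberTheory.EllipticCurves.PAdicLFunctionBranch
import HarnessLib

/-!
# Route PrintX9, crux 19630 `AnalyticMuZeroX9` — PARTIAL, now INPUT-FREE: for every X9 pair SOME EVEN tame
# branch `L_p(E, ω^i)` has `μ = 0`; and the class-free chain AN-9 ⟹ AN-11 ⟹ AN-13 with NO hypothesis left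

Cell `bsd-f3-mu`, width seat p1-w3 (`--supports stmt-BirchSwinnertonDyer-19630`, helper; NOTHING about the
crux itself is booked).  This file is the hypothesis-free upgrade of `PrintX9EvenBranchMuZero.lean` (bsd-print-x9
p2 g3, p572749), whose theorems display THEOREM B (`hB : ConjSpanGenAll`) or its two printed inputs (L) Morris
2007 ∧ (C) Serre 1970 as hypotheses.  Since then the input (V) of THEOREM B — Vaserstein's relative elementary
generation `G(eℤ[1/m], ℤ[1/m]) ≤ E(eℤ[1/m], ℤ[1/m])` — became a TREE THEOREM
(`Literature.NumberTheory.Automorphic.SL2Rel.Away.relG_le_relE_span_natCast`, bsd-print-x8 ty2 g7 p575156, with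
Bass–Milnor–Serre I.3.6 over `ℤ[1/m]` p574472), re-exported as the LINE-B stubs 1a/1b
(`Cruxes.AnalyticMuZeroX10b.TheoremB.stub_vasersteinAway` p575575, `stub_theoremB_of_vasersteinAway` p572175).
Composing, every arrow below is a theorem of the tree and NO named fact, conjecture node or hypothesis
beyond the curve data remains:

* `theoremB : ConjSpanGenAllLevels.ConjSpanGenAll` — THEOREM B (bsd-f3-mu-an g4/g5, MEMO-an §13): for every
  `N` and prime `p ∤ N` the closed `p`-power cyclotomic winding classes span `pr Γ_H(N)` (`ConjSpanGen N p`).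
* `cycWindingNonConstantAt_of_odd` — **AN-9, input-free**: for every `E = W/ℚ`, every ODD prime `p` of good
  reduction with `E[p]` irreducible, `r ↦ [r]⁺_f mod p` is non-constant on the `p`-power cusps
  (`CycWindingNonConstantAt W p`; bsd-print-x8 p1's vertical Stevens bridge).
* `exists_isUnit_one_le_norm_msdMeasure_of_odd` — **AN-11, input-free** (CANDIDATES row 30
  `UnitResidueMeasureOddOrdIrreducible`): `p` odd good ORDINARY, `E[p]` irreducible, `f` a newform of `E`
  ⟹ some value `μ_{f,α}(b + p^{n+1}ℤ_p)` at a UNIT residue `b` is a `p`-adic unit (bsd-f3-mu-an g5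
  `CollapseThree`).
* `evenBranchMuZero` — **AN-13, input-free** (CANDIDATES row 32 `EvenBranchMuZeroOddOrdIrreducible`): under the
  same hypotheses SOME EVEN tame branch `L_p(f, α_E, ω^i, T)`, `i < p − 1`, has a `p`-adic unit coefficient
  (x9 p2's branch certificate `exists_even_branch_norm_coeff_eq_one_of_unit_msdMeasure_of_isNewformOf`).
* `evenBranchMuZeroOnClassX9` — the same on class X9 (`Rank1Residual.ClassX9`: non-CM, `p ≥ 5` good ordinary,
  `E[p]` irreducible, `ρ̄_{E,p}` not surjective), for every newform of `W` — PARTIAL toward crux 19630.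
* `muAnZero_or_branchTwo_five` — at `p = 5` the dichotomy per pair: EITHER the crux's own conclusion
  `∃ n, ‖[Tⁿ] L_5(f, α_W)‖ = 1` (`μ(L_5(E)) = 0`, branch `ω⁰ =` `padicLFunction` by `padicLFunctionBranch_zero`)
  OR `μ(L_5(f, α_W, ω²)) = 0`; `muAnZero_or_branchTwo_or_branchFour_seven` — the trichotomy at `p = 7`.
  (`ClassX9 W p → p = 5 ∨ p = 7` on the census; the statements are for all curves.)

HONEST SCOPE (bsd-f3-mu MEMO-an §10.4 «honest ceiling», barrier note B-an-5; -imc g7 SCOPE CORRECTION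
2026-08-27T21:49Z): non-constancy sees the measure on `ℤ_pˣ`, the `ω⁰`-branch only its push-forward to
`1 + pℤ_p`; for `p ≥ 5` this file does NOT give `μ(L_p(E, ω⁰)) = 0`, and crux 19630 stays OPEN.  At `p = 3`
the only even branch is `ω⁰` and the chain IS Greenberg's analytic `μ₃ = 0` (crux 20682, closed p576451; the
class-free form is `Theorems/GreenbergAnalyticMuZeroThreeOrdinaryIrreducible.lean`).  BSD is not proved by
any of this.  References: [MazurTateTeitelbaum1986Invent] §I.10, §I.13; [GreenbergVatsal2000] §3 Prop. (3.7);
[Vaserstein1972SL2]; [Manin1972] Prop. 1.4; [GreenbergLNM1716] Conj. 1.11.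
-/

-- the summit and its single problem are both named `BirchSwinnertonDyer` (registry layout D-0017)
set_option linter.dupNamespace false

open scoped Classical MatrixGroups ModularForm

open CongruenceSubgroup WeierstrassCurve Literature.NumberTheory.EllipticCurves
  Literature.NumberTheory.EllipticCurves.ModularForms
  Literature.NumberTheory.EllipticCurves.Rank1Residual
  Summit.BirchSwinnertonDyer.BirchSwinnertonDyer.Theorems
  Summit.BirchSwinnertonDyer.BirchSwinnertonDyer.Cruxes.AnalyticMuZeroX10b

namespace Summit.BirchSwinnertonDyer.BirchSwinnertonDyer.Rank1Residual.EvenBranch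

/-- **THEOREM B, input-free** (bsd-f3-mu-an g4/g5): for every level `N` and every prime `p ∤ N`,
`ConjSpanGen N p` — the closed `p`-power cyclotomic winding classes `{0 → a/pⁿ}` span `pr Γ_H(N) ⊆ H₁(X₀(N); ℤ)`,
`H = ⟨±p⟩` (generation form).  Proof: LINE-B stub 1b (orbit trick in `Γ₀(N; ℤ[1/p])`,
`ConjSpanGenAllLevels.conjSpanGenAll_of_vaserstein_away`) applied to stub 1a = Vaserstein's theorem over `ℤ[1/m]`,
a theorem of the tree (`SL2Rel.Away.relG_le_relE_span_natCast`).  [cite: Vaserstein1972SL2, Theorem (p. 313)]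
[cite: Manin1972, Prop. 1.4] -/
theorem theoremB : ConjSpanGenAllLevels.ConjSpanGenAll :=
  TheoremB.stub_theoremB_of_vasersteinAway TheoremB.stub_vasersteinAway

/-- **AN-9, input-free**: for every `E = W/ℚ` (globally minimal model), every ODD prime `p` of good reduction
with `E[p]` irreducible, the rational plus symbol `r ↦ [r]⁺_f mod p` is NON-CONSTANT on the `p`-power cusps for
every newform `f` of `E` (`CycWindingNonConstantAt W p`).  THEOREM B feeds bsd-print-x8 p1's vertical Stevens
bridge `cycWindingNonConstancyOddIrreducible_of_conjSpanGenAll` (irreducibility enters only as «some Hecke prime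
`ℓ ∤ pN` has `a_ℓ ≢ ℓ + 1 (mod p)»`). [cite: MazurTateTeitelbaum1986Invent, §I.10 (10.1)] -/
theorem cycWindingNonConstantAt_of_odd (W : WeierstrassCurve ℚ) [W.IsElliptic] [W.IsGloballyMinimal]
    (p : ℕ) [Fact p.Prime] (hp2 : p ≠ 2) (hgood : W.HasGoodReductionAtPrime p)
    (hirr : W.HasIrreducibleModPGaloisRep p) : CycWindingNonConstantAt W p :=
  PrintX8VerticalStevens.cycWindingNonConstancyOddIrreducible_of_conjSpanGenAll
    (fun M q _ hq hqM ↦ theoremB M q hq hqM) W p hp2 hgood hirr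

/-- **AN-11, input-free** (`UnitResidueMeasureOddOrdIrreducible`, bsd-f3-mu CANDIDATES row 30): for every
`E = W/ℚ`, every ODD good ORDINARY prime `p` with `E[p]` irreducible and every newform `f` of `E`
(`α = unitRoot W p`), the Mazur–Swinnerton-Dyer measure is NOT `≡ 0 (mod p)` on `ℤ_pˣ`: some unit residue
`b mod p^{n+1}` has `1 ≤ ‖μ_{f,α}(b + p^{n+1}ℤ_p)‖`.  AN-9 composed with bsd-f3-mu-an g5's
`CollapseThree.exists_isUnit_one_le_norm_msdMeasure_of_cycWindingNonConstantAt` (MTT (10.1)–(10.2): the measure of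
a ball is `α^{-(n+1)}([b/p^{n+1}]⁺ − α⁻¹[b/pⁿ]⁺)`, `|α|_p = 1`, `p`-integrality of `[·]⁺`).
[cite: MazurTateTeitelbaum1986Invent, §I.10 (10.1)–(10.2)] -/
theorem exists_isUnit_one_le_norm_msdMeasure_of_odd (W : WeierstrassCurve ℚ) [W.IsElliptic]
    [W.IsGloballyMinimal] (p : ℕ) [Fact p.Prime] (hp2 : p ≠ 2) (hord : IsOrdinaryAt W p)
    (hirr : W.HasIrreducibleModPGaloisRep p) {N : ℕ} [NeZero N] (f : CuspForm (Gamma0 N) 2)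
    (hf : IsNewformOf W f) :
    ∃ (n : ℕ) (b : ZMod (p ^ (n + 1))), IsUnit b ∧ 1 ≤ ‖msdMeasure f (unitRoot W p : ℚ_[p]) (n + 1) b‖ :=
  CollapseThree.exists_isUnit_one_le_norm_msdMeasure_of_cycWindingNonConstantAt hp2 W f hord hf hirr
    (cycWindingNonConstantAt_of_odd W p hp2 hord.1 hirr)

/-- **AN-13, input-free** (`EvenBranchMuZeroOddOrdIrreducible`, bsd-f3-mu CANDIDATES row 32): for every
`E = W/ℚ`, every ODD good ordinary `p` with `E[p]` irreducible and every newform `f` of `E`, SOME EVEN tame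
branch `L_p(f, α_E, ω^i, T)`, `i < p − 1`, has a coefficient of `p`-adic norm `1` (`μ(L_p(E, ω^i)) = 0`).
`= evenBranchMuZero_of_conjSpanGenAll theoremB` (x9 p2 g3's composition, with THEOREM B now supplied by the tree).
[cite: MazurTateTeitelbaum1986Invent, §I.13] [cite: GreenbergVatsal2000, §3 Prop. (3.7)] -/
theorem evenBranchMuZero (W : WeierstrassCurve ℚ) [W.IsElliptic] [W.IsGloballyMinimal] (p : ℕ)
    [Fact p.Prime] (hp2 : p ≠ 2) (hord : IsOrdinaryAt W p) (hirr : W.HasIrreducibleModPGaloisRep p)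
    {N : ℕ} [NeZero N] (f : CuspForm (Gamma0 N) 2) (hf : IsNewformOf W f) :
    ∃ i < p - 1, Even i ∧
      ∃ k : ℕ, ‖PowerSeries.coeff k (padicLFunctionBranch f (unitRoot W p : ℚ_[p]) i)‖ = 1 :=
  evenBranchMuZero_of_conjSpanGenAll theoremB W p hp2 hord hirr f hf

/-- **AN-13 on class X9, input-free** (route PrintX9 / SmallImageMuTransfer, crux 19630 — PARTIAL): for every
X9 pair `(W, p)` (`Rank1Residual.ClassX9`: non-CM, `p ≥ 5` good ordinary, `E[p]` irreducible, `ρ̄_{E,p}` NOT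
surjective) and every newform `f` of `W`, SOME EVEN tame branch `L_p(f, α_W, ω^i, T)`, `i < p − 1`, has a
`p`-adic unit coefficient.  No hypothesis beyond the class; image-freeness: non-surjectivity and `¬CM` are not
used.  NOT the crux (`ω⁰` alone is item 19630). [cite: GreenbergLNM1716, §1 Conj. 1.11]
[cite: MazurTateTeitelbaum1986Invent, §I.13] -/
theorem evenBranchMuZeroOnClassX9 (W : WeierstrassCurve ℚ) [W.IsElliptic] [W.IsGloballyMinimal] (p : ℕ)
    [Fact p.Prime] (hX9 : ClassX9 W p) {N : ℕ} [NeZero N] (f : CuspForm (Gamma0 N) 2)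
    (hf : IsNewformOf W f) :
    ∃ i < p - 1, Even i ∧
      ∃ k : ℕ, ‖PowerSeries.coeff k (padicLFunctionBranch f (unitRoot W p : ℚ_[p]) i)‖ = 1 :=
  evenBranchMuZeroOnClassX9_of_conjSpanGenAll theoremB W p hX9 f hf

/-- **The dichotomy at `p = 5`** (the X9 primes are `5` and `7`; 754 of the 790 census pairs have `p = 5`):
for `E = W/ℚ` good ordinary at `5` with `E[5]` irreducible and any newform `f` of `E`, EITHER `L_5(f, α_W)`
itself has a `5`-adic unit coefficient — the per-pair conclusion of crux 19630, `μ(L_5(E)) = 0` — OR the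
branch `L_5(f, α_W, ω², T)` has one (`μ(L_5(E, ω²)) = 0`).  (`i < 4` even forces `i ∈ {0, 2}`; the branch
`ω⁰` IS `padicLFunction`, `padicLFunctionBranch_zero`.)  Input-free. [cite: MazurTateTeitelbaum1986Invent, §I.13] -/
theorem muAnZero_or_branchTwo_five (W : WeierstrassCurve ℚ) [W.IsElliptic] [W.IsGloballyMinimal]
    [Fact (5 : ℕ).Prime] (hord : IsOrdinaryAt W 5) (hirr : W.HasIrreducibleModPGaloisRep 5)
    {N : ℕ} [NeZero N] (f : CuspForm (Gamma0 N) 2) (hf : IsNewformOf W f) :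
    (∃ k : ℕ, ‖PowerSeries.coeff k (padicLFunction f (unitRoot W 5 : ℚ_[5]))‖ = 1) ∨
      ∃ k : ℕ, ‖PowerSeries.coeff k (padicLFunctionBranch f (unitRoot W 5 : ℚ_[5]) 2)‖ = 1 := by
  obtain ⟨i, hi, heven, hk⟩ := evenBranchMuZero W 5 (by decide) hord hirr f hf
  have hi' : i = 0 ∨ i = 2 := by
    rcases Nat.even_iff.mp heven |> fun h => (⟨h, hi⟩ : i % 2 = 0 ∧ i < 5 - 1) with ⟨h0, h4⟩
    omega
  rcases hi' with rfl | rfl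
  · exact Or.inl (by simpa only [padicLFunctionBranch_zero] using hk)
  · exact Or.inr hk

/-- **The trichotomy at `p = 7`** (the 36 census pairs with `7Ns` image): for `E = W/ℚ` good ordinary at `7`
with `E[7]` irreducible and any newform `f` of `E`, one of `L_7(f, α_W)` (`= ω⁰` branch, the conclusion of
crux 19630 at the pair), `L_7(f, α_W, ω²)`, `L_7(f, α_W, ω⁴)` has a `7`-adic unit coefficient.  Input-free.
[cite: MazurTateTeitelbaum1986Invent, §I.13] -/
theorem muAnZero_or_branchTwo_or_branchFour_seven (W : WeierstrassCurve ℚ) [W.IsElliptic]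
    [W.IsGloballyMinimal] [Fact (7 : ℕ).Prime] (hord : IsOrdinaryAt W 7)
    (hirr : W.HasIrreducibleModPGaloisRep 7) {N : ℕ} [NeZero N] (f : CuspForm (Gamma0 N) 2)
    (hf : IsNewformOf W f) :
    (∃ k : ℕ, ‖PowerSeries.coeff k (padicLFunction f (unitRoot W 7 : ℚ_[7]))‖ = 1) ∨
      (∃ k : ℕ, ‖PowerSeries.coeff k (padicLFunctionBranch f (unitRoot W 7 : ℚ_[7]) 2)‖ = 1) ∨
        ∃ k : ℕ, ‖PowerSeries.coeff k (padicLFunctionBranch f (unitRoot W 7 : ℚ_[7]) 4)‖ = 1 := by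
  obtain ⟨i, hi, heven, hk⟩ := evenBranchMuZero W 7 (by decide) hord hirr f hf
  have hi' : i = 0 ∨ i = 2 ∨ i = 4 := by
    have h0 : i % 2 = 0 := Nat.even_iff.mp heven
    omega
  rcases hi' with rfl | rfl | rfl
  · exact Or.inl (by simpa only [padicLFunctionBranch_zero] using hk)
  · exact Or.inr (Or.inl hk)
  · exact Or.inr (Or.inr hk)

end Summit.BirchSwinnertonDyer.BirchSwinnertonDyer.Rank1Residual.EvenBranch
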